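import Literature.Probability.Percolation.TriInnerApproxMarks
import HarnessLib

/-!
# The marked inner approximations converge to the conformal rectangle

Topic `Literature/Probability/Percolation`; family `crit-perc`. The `δ → 0` packaging of the
construction of the marked discrete approximations of a conformal rectangle `R` whose boundary
loop is anticlockwise (Bollobás–Riordan, *Percolation* (2006), Ch. 7 Lemma 14 p. 184 and (28)–(29)
p. 192: "`d_H(Aᵢ⁻, Aᵢ) < 2ε₁` … `G_δ⁻` and `D₄` are `2ε₁`-close"): **for every `ε > 0`, for all small
`δ > 0`, the inner approximation `innerApprox R hδ hc₀` (based at the rounding of a fixed interior point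
`z₀`) can be marked at four boundary darts so that its `i`-th discrete arc and the arc `Aᵢ` of `R` are
mutually within `ε`** (`exists_marked_innerApprox`). The constants of `exists_close_marks`
(`TriInnerApproxMarks.lean`) are produced from `R`: corner distance and corner modulus
(`MarkedDomainCorners.lean`), arc midpoints and their separation (`exists_pos_forall_mem_arc_of_dist_lt`),
mid-arc labelled positions by the creep lemma (`exists_bdryDart_near`), faces near the midpoints by
the swallow lemma (`exists_forall_mem_innerApprox`); the converse closeness uses the creep lemma again
and the corner modulus.

## References

* B. Bollobás, O. Riordan, *Percolation*, Cambridge University Press (2006), Ch. 7 Lemma 14 p. 184,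
  §7.2.5 p. 192, (28)–(29).

## Mathlib / tree

Tree: `TriInnerApproxMarks.lean` (`exists_close_marks`), `TriInnerApproxLimit.lean` (`exists_bdryDart_near`,
`exists_forall_mem_innerApprox`, `closedBall_subset_of_lt_infDist_frontier`), `TriBoundaryZones.lean`,
`MarkedDomainCorners.lean`, `PlanarDomainsTopology.lean`, `TriTethers.lean` (`dist_le_of_mem_triCell_mesh`,
`hexCenter_mem_triCell`), `TriLatticeCells.lean` (`exists_mem_triCell`).
-/

noncomputable section

open Set Metric Filter Topology Literature.Topology.PlaneTopology Literature.Probability.LatticeModels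
  Literature.Probability.RandomPlanarGeometry

namespace Literature.Probability.Percolation

/-- A face of `𝕋` at mesh `δ` containing a given point: all its vertices and its centre are within
`δ`… precisely, its vertices are within `δ` and its centre within `2δ` of the point. [folklore] -/
theorem exists_face_near {δ : ℝ} (hδ : 0 < δ) (y : ℂ) :
    ∃ F : HexVertex, (∀ v ∈ hexFaceVertices F, dist y (triMeshPoint δ v) ≤ δ) ∧ dist (meshCenter δ F) y ≤ 2 * δ := by
  obtain ⟨F, hF⟩ := exists_mem_triCell ((δ⁻¹ : ℂ) * y)
  have hv : ∀ v ∈ hexFaceVertices F, dist y (triMeshPoint δ v) ≤ δ := fun v hv => dist_le_of_mem_triCell_mesh hδ hF hv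
  refine ⟨F, hv, ?_⟩
  obtain ⟨v, hvF⟩ : (hexFaceVertices F).Nonempty := by
    rw [← Finset.card_pos, card_hexFaceVertices]; norm_num
  have h1 : dist (meshCenter δ F) (triMeshPoint δ v) ≤ δ := by
    refine dist_le_of_mem_triCell_mesh hδ ?_ hvF
    rw [meshCenter, ← mul_assoc, inv_mul_cancel₀ (Complex.ofReal_ne_zero.2 hδ.ne'), one_mul]
    exact hexCenter_mem_triCell F
  have h2 := hv v hvF
  have := dist_triangle (meshCenter δ F) (triMeshPoint δ v) y
  rw [dist_comm] at h2
  linarith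

/-- **The marked inner approximations of an anticlockwise conformal rectangle converge to it** (see
the module docstring). [cite: BollobasRiordan2006, Ch. 7 Lemma 14 p. 184, (28)–(29) p. 192] -/
theorem exists_marked_innerApprox (R : ConformalRectangle) (hind : ∀ z ∈ R.carrier, R.index z = 1) {z₀ : ℂ} (hz₀ : z₀ ∈ R.carrier)
    {ε : ℝ} (hε : 0 < ε) :
    ∃ δ₀ > 0, ∀ δ : ℝ, ∀ hδ : 0 < δ, δ < δ₀ → ∃ hc₀ : baseSite z₀ δ ∈ innerCoarse R.carrier δ,
      ∃ G : TriMarkedDomain 4, G.verts = (innerApprox R.toJordanDomain hδ hc₀).verts ∧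
        ∀ i : Fin 4, (∀ y ∈ G.arc i, ∃ z ∈ R.arc i, dist (triMeshPoint δ y) z < ε) ∧
          (∀ z ∈ R.arc i, ∃ y ∈ G.arc i, dist (triMeshPoint δ y) z < ε) := by
  classical
  -- constants of `R`
  obtain ⟨cpt, hcpt0, hcpt⟩ := R.exists_pos_le_dist_pt
  obtain ⟨carc, hcarc0, hcarc⟩ := R.exists_pos_le_infDist_pt_arc
  set tm : Fin 4 → ℝ := fun i => (R.mark i + R.nextMark i) / 2 with htm
  have htmI : ∀ i, tm i ∈ Ioo (R.mark i) (R.nextMark i) := fun i => R.midpoint_mem_Ioo i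
  have hrm : ∀ i : Fin 4, ∃ r > 0, (∀ z ∈ frontier R.carrier, dist z (R.boundary (tm i)) < r → z ∈ R.arc i) ∧
      ∀ j, j ≠ i → ∀ z ∈ R.arc j, r ≤ dist z (R.boundary (tm i)) := fun i => R.exists_pos_forall_mem_arc_of_dist_lt i (htmI i)
  choose rm hrm0 hrm1 hrm2 using hrm
  set rmin := min (min (rm 0) (rm 1)) (min (rm 2) (rm 3)) with hrmin
  have hrmin0 : 0 < rmin := by simp only [hrmin, lt_min_iff]; exact ⟨⟨hrm0 0, hrm0 1⟩, hrm0 2, hrm0 3⟩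
  have hrmin_le : ∀ i, rmin ≤ rm i := by
    intro i; fin_cases i <;> simp [hrmin]
  -- the scale `ρ`
  set ρ := min (ε / 4) (min (cpt / 8) (min (carc / 4) (rmin / 8))) with hρ
  have hρ0 : 0 < ρ := by simp only [hρ, lt_min_iff]; exact ⟨by linarith, by linarith, by linarith, by linarith⟩
  have hρε : ρ ≤ ε / 4 := min_le_left _ _
  have hρcpt : ρ ≤ cpt / 8 := (min_le_right _ _).trans (min_le_left _ _)
  have hρcarc : ρ ≤ carc / 4 := (min_le_right _ _).trans ((min_le_right _ _).trans (min_le_left _ _))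
  have hρrm : ρ ≤ rmin / 8 := (min_le_right _ _).trans ((min_le_right _ _).trans (min_le_right _ _))
  -- the corner modulus of `ρ`
  obtain ⟨η, hη0, hη⟩ := R.exists_corner_modulus hρ0
  -- the creep tolerance and the creep lemma
  set εc := min (ρ / 2) (η / 4) with hεc
  have hεc0 : 0 < εc := lt_min (by linarith) (by linarith)
  have hεcρ : εc ≤ ρ / 2 := min_le_left _ _
  have hεcη : εc ≤ η / 4 := min_le_right _ _
  obtain ⟨δ₁, hδ₁, hcreep⟩ := exists_bdryDart_near R.toJordanDomain hz₀ hεc0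
  -- interior points near the arc midpoints and the swallow lemma on small balls about them
  have hy : ∀ i : Fin 4, ∃ y ∈ R.carrier, dist y (R.boundary (tm i)) < rm i / 8 := fun i =>
    R.exists_mem_carrier_dist_lt i (boundary_mem_arc_of_mem_Icc R i ⟨(htmI i).1.le, (htmI i).2.le⟩) (by linarith [hrm0 i])
  choose y hyR hyd using hy
  set s : Fin 4 → ℝ := fun i => infDist (y i) (frontier R.carrier) / 2 with hs
  have hs0 : ∀ i, 0 < s i := fun i => by simp only [hs]; linarith [R.toJordanDomain.infDist_frontier_pos (hyR i)]
  have hKR : ∀ i, closedBall (y i) (s i) ⊆ R.carrier := fun i =>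
    closedBall_subset_of_lt_infDist_frontier R.isOpen (hyR i) (by simp only [hs]; linarith [R.toJordanDomain.infDist_frontier_pos (hyR i)])
  have hsw : ∀ i : Fin 4, ∃ δ₂ > 0, ∀ δ : ℝ, ∀ hδ : 0 < δ, δ < δ₂ → ∃ hc₀ : baseSite z₀ δ ∈ innerCoarse R.carrier δ,
      ∀ x : Site 2, triMeshPoint δ x ∈ closedBall (y i) (s i) → x ∈ (innerApprox R.toJordanDomain hδ hc₀).verts := fun i =>
    exists_forall_mem_innerApprox R.toJordanDomain hz₀ (isCompact_closedBall _ _) (hKR i)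
  choose δ₂ hδ₂ hswallow using hsw
  set smin := min (min (s 0) (s 1)) (min (s 2) (s 3)) with hsmin
  have hsmin0 : 0 < smin := by simp only [hsmin, lt_min_iff]; exact ⟨⟨hs0 0, hs0 1⟩, hs0 2, hs0 3⟩
  have hsmin_le : ∀ i, smin ≤ s i := by
    intro i; fin_cases i <;> simp [hsmin]
  set δ₂m := min (min (δ₂ 0) (δ₂ 1)) (min (δ₂ 2) (δ₂ 3)) with hδ₂m
  have hδ₂m0 : 0 < δ₂m := by simp only [hδ₂m, lt_min_iff]; exact ⟨⟨hδ₂ 0, hδ₂ 1⟩, hδ₂ 2, hδ₂ 3⟩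
  have hδ₂m_le : ∀ i, δ₂m ≤ δ₂ i := by
    intro i; fin_cases i <;> simp [hδ₂m]
  -- the threshold
  refine ⟨min δ₁ (min δ₂m (min (η / 96) (min (ρ / 700) smin))), by positivity, fun δ hδ hδlt => ?_⟩
  have hδ1 : δ < δ₁ := hδlt.trans_le (min_le_left _ _)
  have hδ2 : ∀ i, δ < δ₂ i := fun i => (hδlt.trans_le ((min_le_right _ _).trans (min_le_left _ _))).trans_le (hδ₂m_le i)
  have hδη : δ < η / 96 := hδlt.trans_le ((min_le_right _ _).trans ((min_le_right _ _).trans (min_le_left _ _)))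
  have hδρ : δ < ρ / 700 := hδlt.trans_le ((min_le_right _ _).trans ((min_le_right _ _).trans ((min_le_right _ _).trans (min_le_left _ _))))
  have hδs : ∀ i, δ < s i := fun i =>
    (hδlt.trans_le ((min_le_right _ _).trans ((min_le_right _ _).trans ((min_le_right _ _).trans (min_le_right _ _))))).trans_le (hsmin_le i)
  obtain ⟨hc₀, hdart⟩ := hcreep δ hδ hδ1
  refine ⟨hc₀, ?_⟩
  set G₀ := innerApprox R.toJordanDomain hδ hc₀ with hG₀
  set N := (triBdryDarts G₀.verts).card with hN
  -- darts near boundary points, as positions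
  have hpos : ∀ p ∈ frontier R.carrier, ∃ n, n < N ∧ dist p (triMeshPoint δ (ztail R hδ hc₀ n)) < εc := by
    intro p hp
    obtain ⟨d, hd, hdp⟩ := hdart p hp
    obtain ⟨n, hn, hnd⟩ := G₀.isTriDisc.cycle d hd
    exact ⟨n, hn, by rw [ztail, bdryTail, hnd]; exact hdp⟩
  have htail : ∀ n, dist (ztip R hδ hc₀ n) (triMeshPoint δ (ztail R hδ hc₀ n)) ≤ 12 * δ := dist_ztip_ztail_le
  -- positions whose tip is near the midpoint of `A_i` are labelled `i`
  have hlabel_of_near : ∀ (i : Fin 4) (n : ℕ), dist (ztip R hδ hc₀ n) (R.boundary (tm i)) < ρ → IsLabel R hδ hc₀ n i := by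
    intro i n hn
    have hρi : ρ < rm i := by linarith [hrmin_le i, hrm0 i]
    refine ⟨hrm1 i _ (ztip_mem_frontier n) (hn.trans hρi), fun k hki x hx => ?_⟩
    have h1 := hrm2 i k hki x hx
    have := dist_triangle x (ztip R hδ hc₀ n) (R.boundary (tm i))
    rw [dist_comm x (ztip R hδ hc₀ n)] at this
    linarith [hrmin_le i]
  -- mid-arc labelled positions
  have hμ : ∀ i : Fin 4, ∃ n, dist (ztip R hδ hc₀ n) (R.boundary (tm i)) < ρ := by
    intro i
    obtain ⟨n, -, hn⟩ := hpos (R.boundary (tm i)) (R.boundary_mem_frontier _)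
    refine ⟨n, ?_⟩
    have h1 := htail n
    have := dist_triangle (ztip R hδ hc₀ n) (triMeshPoint δ (ztail R hδ hc₀ n)) (R.boundary (tm i))
    rw [dist_comm (triMeshPoint δ _)] at this
    linarith
  choose μ hμx using hμ
  have hμl : ∀ i, IsLabel R hδ hc₀ (μ i) i := fun i => hlabel_of_near i (μ i) (hμx i)
  -- faces of `G` near the midpoints
  have hxF : ∀ i : Fin 4, ∃ F₀ : HexVertex, hexFaceVertices F₀ ⊆ G₀.verts ∧ dist (meshCenter δ F₀) (R.boundary (tm i)) < rm i / 2 := by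
    intro i
    obtain ⟨F, hFv, hFc⟩ := exists_face_near hδ (y i)
    obtain ⟨_, hK⟩ := hswallow i δ hδ (hδ2 i)
    refine ⟨F, fun v hv => hK v (mem_closedBall.2 ?_), ?_⟩
    · rw [dist_comm]; exact (hFv v hv).trans (hδs i).le
    · have := dist_triangle (meshCenter δ F) (y i) (R.boundary (tm i))
      have h2 := hyd i
      have : δ < rm i / 8 := by linarith [hrmin_le i]
      linarith
  -- at least seven boundary darts: the traversal joins a tail near the midpoint of `A_0` to a tail near
  -- the midpoint of `A_2`, at distance `≥ rm 0 - ρ ≥ 7ρ > 4900 δ`, moving `≤ δ` per step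
  have h7 : 7 ≤ N := by
    have hsteps : ∀ n t : ℕ, dist (triMeshPoint δ (ztail R hδ hc₀ (n + t))) (triMeshPoint δ (ztail R hδ hc₀ n)) ≤ δ * t := by
      intro n t
      induction t with
      | zero => simp
      | succ t ih =>
        have h := dist_ztail_succ_le (R := R) (hδ := hδ) (hc₀ := hc₀) (n + t)
        have := dist_triangle (triMeshPoint δ (ztail R hδ hc₀ (n + t + 1))) (triMeshPoint δ (ztail R hδ hc₀ (n + t)))
          (triMeshPoint δ (ztail R hδ hc₀ n))
        rw [dist_comm] at h
        rw [show n + (t + 1) = n + t + 1 by ring]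
        push_cast
        nlinarith [hδ.le]
    obtain ⟨na, hna, hda⟩ := hpos (R.boundary (tm 0)) (R.boundary_mem_frontier _)
    obtain ⟨nb, hnb, hdb⟩ := hpos (R.boundary (tm 2)) (R.boundary_mem_frontier _)
    have hfar : rm 0 ≤ dist (R.boundary (tm 2)) (R.boundary (tm 0)) :=
      hrm2 0 2 (by decide) _ (boundary_mem_arc_of_mem_Icc R 2 ⟨(htmI 2).1.le, (htmI 2).2.le⟩)
    have hab : dist (triMeshPoint δ (ztail R hδ hc₀ na)) (triMeshPoint δ (ztail R hδ hc₀ nb)) ≤ δ * N := by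
      rcases le_total na nb with h | h
      · obtain ⟨t, rfl⟩ : ∃ t, nb = na + t := ⟨nb - na, by omega⟩
        have ht : (t : ℝ) ≤ N := by exact_mod_cast (show t ≤ N by omega)
        rw [dist_comm]
        exact (hsteps na t).trans (by nlinarith [hδ.le])
      · obtain ⟨t, rfl⟩ : ∃ t, na = nb + t := ⟨na - nb, by omega⟩
        have ht : (t : ℝ) ≤ N := by exact_mod_cast (show t ≤ N by omega)
        exact (hsteps nb t).trans (by nlinarith [hδ.le])
    have := dist_triangle4 (R.boundary (tm 2)) (triMeshPoint δ (ztail R hδ hc₀ nb)) (triMeshPoint δ (ztail R hδ hc₀ na)) (R.boundary (tm 0))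
    rw [dist_comm (triMeshPoint δ (ztail R hδ hc₀ nb))] at this
    rw [dist_comm] at hda
    have hN7 : (7 : ℝ) ≤ N := by nlinarith [hrmin_le 0, hδ]
    exact_mod_cast hN7
  -- the marked domain
  have h48 : 48 * δ < η := by linarith
  have hρpt : 2 * ρ + 25 * δ < cpt := by linarith
  have hρarc : ρ + 25 * δ < carc := by linarith
  have hρarc' : ρ + 48 * δ ≤ carc := by linarith
  have hsmall : ∀ i, ρ + ρ + 260 * δ < rm i := fun i => by linarith [hrmin_le i]
  have hρr : ∀ i, ρ + 25 * δ < rm i / 2 := fun i => by linarith [hrmin_le i]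
  have hinjc : 2 * (ρ + 340 * δ) < cpt := by linarith
  obtain ⟨G, hGv, hG⟩ := exists_close_marks R hδ hc₀ hind hη h48 hcpt hρpt hcarc hρarc htmI hrm2 hrm0 (ε' := ρ) hsmall hρr hxF hμl hμx
    h7 hinjc hρarc'
  refine ⟨G, hGv, fun i => ⟨fun y hy => ?_, fun z hz => ?_⟩⟩
  · obtain ⟨z, hz, hd⟩ := (hG i).1 y hy
    exact ⟨z, hz, by linarith⟩
  · obtain ⟨hA, hB, ⟨yi, hyi, hdi⟩, ⟨yi', hyi', hdi'⟩⟩ := hG i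
    obtain ⟨n, -, hn⟩ := hpos z (R.arc_subset_frontier i hz)
    -- the tip of `n` is near `z`
    have htipz : dist (ztip R hδ hc₀ n) z < εc + 12 * δ := by
      have h1 := htail n
      have := dist_triangle (ztip R hδ hc₀ n) (triMeshPoint δ (ztail R hδ hc₀ n)) z
      rw [dist_comm (triMeshPoint δ _)] at this
      linarith
    by_cases hni : IsLabel R hδ hc₀ n i
    · rcases hB n hni with h | h
      · exact ⟨_, h, by rw [dist_comm] at hn; linarith⟩
      · refine ⟨yi, hyi, ?_⟩
        have := dist_triangle4 (triMeshPoint δ yi) (R.pt i) (triMeshPoint δ (ztail R hδ hc₀ n)) z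
        rw [dist_comm (R.pt i)] at this
        rw [dist_comm] at hn
        linarith
    · -- the tip of `n` is near `P_i` or `P_{i+1}`
      have hnear : ∃ m : Fin 4, (m = i ∨ m = i + 1) ∧ dist (ztip R hδ hc₀ n) (R.pt m) < ρ := by
        have hinfi : infDist (ztip R hδ hc₀ n) (R.arc i) < η := by
          refine (infDist_le_dist_of_mem hz).trans_lt ?_; linarith
        rcases exists_zone (R := R) (hδ := hδ) (hc₀ := hc₀) hη h48 n with ⟨k, hk⟩ | ⟨m, hm⟩
        · have hki : k ≠ i := fun h => hni (h ▸ hk)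
          have hinfk : infDist (ztip R hδ hc₀ n) (R.arc k) < η := by rw [infDist_zero_of_mem hk.1]; exact hη0
          obtain ⟨m, -, hmi, hmd⟩ := hη _ (ztip_mem_frontier n) k i (Ne.symm hki) hinfk hinfi
          exact ⟨m, R.pt_mem_arc_iff.1 hmi, hmd⟩
        · refine ⟨m, ?_, hm.2⟩
          by_contra hno
          push Not at hno
          have hPm : R.pt m ∉ R.arc i := fun h => by
            rcases R.pt_mem_arc_iff.1 h with h' | h'
            · exact hno.1 h'
            · exact hno.2 h'
          have h1 := hcarc m i hPm
          have h2 : infDist (R.pt m) (R.arc i) ≤ dist (R.pt m) z := infDist_le_dist_of_mem hz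
          have h3 := hm.2
          have := dist_triangle (R.pt m) (ztip R hδ hc₀ n) z
          rw [dist_comm] at h3
          linarith
      obtain ⟨m, hm, hmd⟩ := hnear
      have key : ∀ {y' : Site 2}, y' ∈ G.arc i → dist (triMeshPoint δ y') (R.pt m) < ρ + 340 * δ →
          ∃ y ∈ G.arc i, dist (triMeshPoint δ y) z < ε := by
        intro y' hy' hd'
        refine ⟨y', hy', ?_⟩
        have := dist_triangle4 (triMeshPoint δ y') (R.pt m) (ztip R hδ hc₀ n) z
        rw [dist_comm (R.pt m)] at this
        linarith
      rcases hm with rfl | rfl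
      · exact key hyi hdi
      · exact key hyi' hdi'

end Literature.Probability.Percolation
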